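import Literature.NumberTheory.LFunctions.BurnolEvaluatorsMinimal
import Literature.NumberTheory.LFunctions.BurnolEvaluatorProofs
import Literature.NumberTheory.LFunctions.BurnolScriptL1DensityProofs
import Literature.NumberTheory.LFunctions.WeilMellinBounds
import Literature.NumberTheory.LFunctions.BurnolCoPoissonEvaluatorOrthogonality
import Literature.NumberTheory.LFunctions.BurnolZetaEvaluatorsProjectionProofs
import HarnessLib

/-!
# Burnol 2004b, Thm. 6.7: for `a < 1` the evaluators `Z^a_{ρ,k}` are a minimal system in `K_a`

LINE 1 — LABEL: RH-FREE (minimality of the system of evaluators `Z^a_{ρ,k}`, `0 ≤ k < m_ρ`, of de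
Branges' Sonine space `K_a`, `0 < a < 1`, indexed by the non-trivial zeros of `ζ` WHEREVER they lie,
with their multiplicities). FRAMING (cell rh-crit, D-0074): corpus theorems are RH-FREE literature;
nothing here is worded as progress toward RH. bears_on: B-C/B-P (LADDER-RH COLUMN 6, de Branges
framework) as [Burnol2004b, Thm. 6.7] (`Burnol2004b_thm6_7`, the "`a < 1` ⇒ minimal" constituent of
Thm. 3.2). WHAT THIS IS NOT: not a route, not a criterion, no positivity at `E_ζ`; which vectors are
minimal in which Sonine space is corpus vocabulary and moves RH by nothing. Nothing here bears on the
truth of RH.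

Source: J.-F. Burnol, *Two complete and minimal systems associated with the zeros of the Riemann zeta
function*, J. Théor. Nombres Bordeaux **16** (2004) 65–94 = arXiv:math/0203120v7 [Burnol2004b], §6
Thm. 6.7 and its proof, TeX of record `rh-crit/dbl/src/Burnol2004JTNB_arXivmath0203120v7.tex`
l.1340–1375:

> **Theorem 6.7.** Let `a < 1`. The vectors `Z^a_{ρ,k}` are minimal in `K_a`.
> *Proof.* Let `θ(t)` be a smooth non-zero function supported in `[a, A]` (`A = 1/a > 1`) … the
> function `G(s) = s(s−1)θ̂(s)ζ(s)` … is the right Mellin transform of a (non-zero) element `g` of `K_a`.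
> Let us now take a non-trivial zero `ρ`, which for simplicity we assume simple. We choose the function
> `θ(t)` to be such that `θ̂(ρ) ≠ 0` … Then, using [Prop. 4.2], `G(s)/(s−ρ)` is again the Mellin
> transform of a non-zero element `g_ρ` in `K_a`. This element is perpendicular (for the bilinear form
> `[f,g]`) to all the evaluators except `Z^a_{ρ,0}`, to which it is not perpendicular. So `Z^a_{ρ,0}` can
> not be in the closed span of the others. The proof is easily extended to the case of a multiple zero
> (we don't do this here, as the next section contains a proof of a more general statement).

## How the printed proof is followed (tree inputs)

* "`θ` smooth supported in `[a, 1/a]`, `G(s) = s(s−1)θ̂(s)ζ(s)`": in the additive avatar `τ = log u`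
  of the tree's multiplicative mollifier (`Literature.NumberTheory.ConnesConsani2021.scalingOp`, the
  Bochner integral `ϑ(w) = ∫ w(τ)ϑ(e^τ)dτ` of the unitary scaling `(ϑ(e^τ)g)(v) = e^{−τ/2}g(e^{−τ}v)`,
  with Mellin multiplier `Θ_w(s) = ∫ w(τ)e^{τ(1/2−s)}dτ`, [Burnol2004b, Thm. 4.9]'s kit in
  `BurnolScriptL1DensityProofs.lean`) the weight is `w = ψ″ − ψ/4` for a smooth `ψ` supported in
  `[log a, −log a]`, so that `Θ_w(s) = s(s−1)Θ_ψ(s)` (two integrations by parts,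
  `weilMellin_deriv_deriv`): this is print's factor `s(s−1)θ̂(s)`; `ψ = (bump) × e^{τ(1/2−ρ̄)}` makes
  `Θ_ψ(ρ) = ∫ bump · e^{τ(1−2Re ρ)} > 0`, print's "`θ̂(ρ) ≠ 0`, which obviously may always be arranged".
* "using [Prop. 4.2], `G(s)/(s−ρ)` is again the Mellin transform of a non-zero element `g_ρ` in `K_a`"
  (print's `\ref{zetaprop}` is Prop. 4.2, "the functions `ζ(s)/(s−ρ)^l`, `1 ≤ l ≤ m_ρ` … belong to
  `L̂_1`", TeX l.688): exactly as in print, we START from the vectors `v_{ρ,l} ∈ L_1` with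
  `v̂_{ρ,l} = ζ(s)/(s−ρ)^l`, `1 ≤ l ≤ m_ρ` (Prop. 4.2, a tree theorem:
  `BurnolZetaDuality.isZetaQuotientVector_zetaQuotientVector`) and mollify them:
  `g_{ρ,l} := ϑ(w)v_{ρ,l}` has continued transform `Θ_w(s)ζ(s)/(s−ρ)^l = G(s)/(s−ρ)^l · (Θ_ψ/θ̂)` — the
  same functions as in print. `g_{ρ,l} ∈ K_a`: `v_{ρ,l}` and its cosine transform are CONSTANT on
  `(0,1)`, so `ϑ(w)v_{ρ,l}` and `𝓕(ϑ(w)v_{ρ,l}) = ϑ(w(−·))𝓕v_{ρ,l}` are constant on `(0,a)` with constants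
  `c·Θ_w(1) = 0` and `c′·Θ_w(0) = 0` (this is print's "`G(s)` … belongs to `A^sℍ²` … `χ(s)G(1−s)` … again
  belongs to `A^sℍ²`", done on the function side exactly as in the tree's proof of Thm. 4.9).
* "perpendicular (for `[f,g]`) to all the evaluators except …": `[g_{ρ,l}, Z^a_{ρ′,k}] =
  (d/ds)^k[Γ_ℝ(s)Θ_w(s)ζ(s)/(s−ρ)^l]_{s=ρ′}` (the evaluators EXIST and evaluate,
  `BurnolEvaluators.isBurnolZ_burnolZ`), which vanishes for `ρ′ ≠ ρ`, `k < m_{ρ′}`, vanishes for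
  `ρ′ = ρ`, `k + l < m_ρ`, and does NOT vanish for `k + l = m_ρ` (analytic orders, as in
  `BurnolZetaSystemsDuality.lean`).
* "easily extended to the case of a multiple zero (we don't do this here, as the next section contains a
  proof of a more general statement)" — the one departure from the printed TEXT: instead of §7
  (Lemma 7.4) the multiple-zero case is closed by the triangular inversion
  `BurnolZetaMinimal.exists_dual_functional` (the tree's proof of Thm. 3.3 (ii) / Thm. 6.3), verbatim as
  in `BurnolEvaluatorsMinimal.isMinimalSystem_burnolYSystem`, on the vectors `g_{ρ,l}`, `1 ≤ l ≤ m_ρ`.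

## What is proved (theorems only; no definition, no named fact; net debt −1)

* `BurnolZEvaluatorsMinimal.scalingUnitary_scalingOp_comm`, `scalingUnitary_ae_const_Ioo_scale`,
  `scalingOp_ae_const_Ioo_scale`, `rightMellin_scalingOp_scale` — the mollifier kit of
  `BurnolScriptL1DensityProofs.lean` (normalised there to the interval `(0,1)`) at an arbitrary scale
  `(0,a)`, by conjugating with the fixed dilation `ϑ(a⁻¹)`;
* `BurnolZEvaluatorsMinimal.scalingOp_mem_sonineK` — `ϑ(w)v ∈ K_a` for `v ∈ L_1` and a weight supported
  in `[log a, −log a]` with `Θ_w(0) = Θ_w(1) = 0`;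
* `BurnolZEvaluatorsMinimal.exists_weight` — the weight `w` with `Θ_w(0) = Θ_w(1) = 0 ≠ Θ_w(ρ)`;
* `BurnolZEvaluatorsMinimal.rightMellinExt_scalingOp_zetaQuotientVector`, `pairing_eq_iteratedDeriv`,
  `pairing_self_eq_zero`, `pairing_self_ne_zero`, `pairing_of_ne_eq_zero` — the dual family and its
  triangular pairings with the `Z^a_{ρ′,k}`;
* **`BurnolZEvaluatorsMinimal.isMinimalSystem_burnolZSystem`**, **`Burnol2004b_thm6_7_holds :
  Burnol2004b_thm6_7`** — the DISCHARGE;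
* `Burnol2004b_thm3_2_lt_one` — the `a < 1` clause of Thm. 3.2 (`Burnol2004b_thm3_2`), verbatim and
  hypothesis-free (minimal: Thm. 6.7; not complete: the co-Poisson vectors of
  `BurnolCoPoissonEvaluatorOrthogonality.lean`, `not_isCompleteSystemIn_sonineK_burnolZSystem`);
  `Burnol2004b_thm3_2_of_prop6_5_of_prop6_6`, `Burnol2004b_thm3_2_of_prop6_5_of_prop6_2` — the typed
  Thm. 3.2 is now exactly Props. 6.5 and 6.6 (resp. 6.5 and 6.2, through
  `Burnol2004b_prop6_6_of_prop6_2`) away.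

## References

* [Burnol2004b] J.-F. Burnol, JTNB 16 (2004) 65–94 = arXiv:math/0203120v7, Thm. 6.7 (p. 17, TeX
  l.1340–1375); Prop. 4.2, Thm. 4.9 (proof), Thm. 3.3.
* [ConnesConsani2021] A. Connes, C. Consani, Selecta Math. 27 (2021) 77, §4 eq. (40) (the unitary
  scaling `ϑ`; tree `ScalingOperator.lean`).
-/

noncomputable section

open MeasureTheory Complex Filter Set
open scoped Topology ComplexConjugate FourierTransform ContDiff

namespace Literature.NumberTheory.LFunctions

namespace BurnolZEvaluatorsMinimal

open Literature.NumberTheory.ConnesConsani2021 (scalingUnitary scalingOp scalingUnitary_coeFn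
  scalingUnitary_add scalingUnitary_zero integrable_smul_scalingUnitary scalingOp_apply)
open BurnolScriptL1Density BurnolZetaHardy BurnolEvaluators BurnolZetaDuality BurnolZetaMinimal
  BurnolEvaluatorsMinimal

/-! ## A. The multiplicative mollifier at an arbitrary scale `(0, a)`

`BurnolScriptL1DensityProofs.lean` proves the support and Mellin bookkeeping of `ϑ(w)h` with the
conclusion normalised to the interval `(0,1)`; conjugating with the fixed unitary dilation
`ϑ(e^σ)`, `e^{−σ} = a`, moves it to `(0,a)`. Throughout `Θ_w(s) = ∫ τ, w τ * cexp (τ * (1/2 − s))` is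
written out (this module declares no definitions). -/

/-- Quasi-measure-preservation of `x ↦ c x` (`c ≠ 0`) for Lebesgue measure. [folklore] -/
private theorem quasiMeasurePreserving_mul_left {c : ℝ} (hc : c ≠ 0) :
    Measure.QuasiMeasurePreserving (fun x : ℝ ↦ c * x) volume volume :=
  (Literature.Analysis.Fourier.measurePreserving_mul_left hc).quasiMeasurePreserving.mono_right
    Measure.smul_absolutelyContinuous

/-- **`ϑ(e^σ)` commutes with every `ϑ(w)`** (the scaling group is abelian and a bounded operator
passes through the Bochner integral). [cite: ConnesConsani2021, §4 eq. (40) p. 15 ("the unitary representation ϑ")] -/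
theorem scalingUnitary_scalingOp_comm {w : ℝ → ℂ} (hw : Integrable w) (σ : ℝ)
    (v : Lp ℂ 2 (volume : Measure ℝ)) :
    scalingUnitary σ (scalingOp w v) = scalingOp w (scalingUnitary σ v) := by
  rw [scalingOp_apply hw, scalingOp_apply hw,
    ← ContinuousLinearMap.integral_comp_comm (scalingUnitary σ) (integrable_smul_scalingUnitary hw v)]
  refine integral_congr_ae (Eventually.of_forall fun τ ↦ ?_)
  dsimp only
  rw [ContinuousLinearMap.map_smul, ← ContinuousLinearMap.comp_apply (scalingUnitary σ),
    ← scalingUnitary_add, add_comm, scalingUnitary_add, ContinuousLinearMap.comp_apply]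

/-- `ϑ(e^{−σ})ϑ(e^{σ}) = 1` on vectors. [cite: ConnesConsani2021, §4 eq. (40) p. 15] -/
theorem scalingUnitary_neg_apply (σ : ℝ) (f : Lp ℂ 2 (volume : Measure ℝ)) :
    scalingUnitary (-σ) (scalingUnitary σ f) = f := by
  rw [← ContinuousLinearMap.comp_apply, ← scalingUnitary_add, neg_add_cancel, scalingUnitary_zero]
  rfl

/-- **Dilates of a function constant near `0⁺`, at scale `a`.** If `h = c` a.e. on `(0, b)` and
`a e^{−τ} ≤ b`, then `ϑ(e^τ)h = e^{−τ/2} c` a.e. on `(0, a)`.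
[cite: Burnol2004b, proof of Thm. 4.9 (arXiv:math/0203120v7 p. 11, TeX l.925–931)] -/
theorem scalingUnitary_ae_const_Ioo_scale {h : Lp ℂ 2 (volume : Measure ℝ)} {a b : ℝ} {c : ℂ}
    (hc : ∀ᵐ x : ℝ, x ∈ Ioo 0 b → (h : ℝ → ℂ) x = c) {τ : ℝ} (hτ : a * Real.exp (-τ) ≤ b) :
    ∀ᵐ x : ℝ, x ∈ Ioo (0 : ℝ) a →
      (scalingUnitary τ h : ℝ → ℂ) x = (Real.exp (-τ / 2) : ℂ) * c := by
  have hq := quasiMeasurePreserving_mul_left (Real.exp_pos (-τ)).ne'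
  filter_upwards [scalingUnitary_coeFn τ h, hq.ae hc] with x hx hx' hxa
  rw [hx, hx' ⟨mul_pos (Real.exp_pos _) hxa.1, ?_⟩]
  calc Real.exp (-τ) * x < Real.exp (-τ) * a := by gcongr; exact hxa.2
    _ = a * Real.exp (-τ) := mul_comm _ _
    _ ≤ b := hτ

/-- **The mollifier of a function constant near `0⁺` is constant near `0⁺`, at scale `a`:** if
`h = c` a.e. on `(0,b)` and the weight lives on `{τ : a e^{−τ} ≤ b}`, then
`ϑ(w)h = c ∫ w(τ)e^{−τ/2}dτ` a.e. on `(0,a)` (`a > 0`).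
[cite: Burnol2004b, proof of Thm. 4.9 (arXiv:math/0203120v7 p. 11, TeX l.925–931)] -/
theorem scalingOp_ae_const_Ioo_scale {w : ℝ → ℂ} (hw : Integrable w) {a b : ℝ} (ha : 0 < a)
    (hwb : ∀ τ, w τ ≠ 0 → a * Real.exp (-τ) ≤ b) {h : Lp ℂ 2 (volume : Measure ℝ)} {c : ℂ}
    (hc : ∀ᵐ x : ℝ, x ∈ Ioo 0 b → (h : ℝ → ℂ) x = c) :
    ∀ᵐ x : ℝ, x ∈ Ioo (0 : ℝ) a →
      (scalingOp w h : ℝ → ℂ) x = c * ∫ τ : ℝ, w τ * (Real.exp (-τ / 2) : ℂ) := by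
  set σ : ℝ := -Real.log a with hσ
  have hσa : Real.exp (-σ) = a := by rw [hσ, neg_neg, Real.exp_log ha]
  have hσa' : a * Real.exp (-(-σ)) ≤ 1 := by
    rw [neg_neg, hσ, Real.exp_neg, Real.exp_log ha, mul_inv_cancel₀ ha.ne']
  -- `ϑ(e^σ)h` is constant on `(0, b/a)`
  have h1 : ∀ᵐ x : ℝ, x ∈ Ioo 0 (b / a) →
      (scalingUnitary σ h : ℝ → ℂ) x = (Real.exp (-σ / 2) : ℂ) * c :=
    scalingUnitary_ae_const_Ioo_scale hc (by rw [hσa, div_mul_cancel₀ b ha.ne'])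
  have hwb' : ∀ τ, w τ ≠ 0 → Real.exp (-τ) ≤ b / a := fun τ hτ ↦ by
    rw [le_div_iff₀ ha, mul_comm]; exact hwb τ hτ
  -- the `(0,1)`-normalised lemma for `ϑ(w)ϑ(e^σ)h = ϑ(e^σ)ϑ(w)h`
  have h2 := scalingOp_ae_const_Ioo hw hwb' h1
  rw [← scalingUnitary_scalingOp_comm hw] at h2
  -- pull back through `ϑ(e^{−σ})`
  have h3 := scalingUnitary_ae_const_Ioo_scale (a := a) (τ := -σ) h2 hσa'
  rw [scalingUnitary_neg_apply] at h3
  have hee : (Real.exp (-(-σ) / 2) : ℂ) * (Real.exp (-σ / 2) : ℂ) = 1 := by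
    rw [← Complex.ofReal_mul, ← Real.exp_add, show -(-σ) / 2 + -σ / 2 = 0 by ring, Real.exp_zero,
      Complex.ofReal_one]
  filter_upwards [h3] with x hx hxa
  rw [hx hxa]
  calc (Real.exp (-(-σ) / 2) : ℂ) * ((Real.exp (-σ / 2) : ℂ) * c *
        ∫ τ : ℝ, w τ * (Real.exp (-τ / 2) : ℂ))
      = ((Real.exp (-(-σ) / 2) : ℂ) * (Real.exp (-σ / 2) : ℂ)) *
          (c * ∫ τ : ℝ, w τ * (Real.exp (-τ / 2) : ℂ)) := by ring
    _ = c * ∫ τ : ℝ, w τ * (Real.exp (-τ / 2) : ℂ) := by rw [hee, one_mul]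

/-- **`(ϑ(w)h)^(s) = Θ_w(s) ĥ(s)` on `1/2 < Re s < 1`, at scale `a`**: for `h ∈ L²` constant on `(0,b)`
and a continuous compactly supported weight living on `{τ : a e^{−τ} ≤ b}` (`a > 0`).
[cite: Burnol2004b, proof of Thm. 4.9 (arXiv:math/0203120v7 p. 11, TeX l.917–925)] -/
theorem rightMellin_scalingOp_scale {w : ℝ → ℂ} (hw : Continuous w) (hws : HasCompactSupport w)
    {a b : ℝ} (ha : 0 < a) (hwb : ∀ τ, w τ ≠ 0 → a * Real.exp (-τ) ≤ b)
    {h : Lp ℂ 2 (volume : Measure ℝ)} {c : ℂ} (hc : ∀ᵐ x : ℝ, x ∈ Ioo 0 b → (h : ℝ → ℂ) x = c)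
    {s : ℂ} (hs1 : 1 / 2 < s.re) (hs2 : s.re < 1) :
    rightMellin (scalingOp w h : ℝ → ℂ) s =
      (∫ τ : ℝ, w τ * cexp ((τ : ℂ) * (1 / 2 - s))) * rightMellin (h : ℝ → ℂ) s := by
  have hwi : Integrable w := hw.integrable_of_hasCompactSupport hws
  set σ : ℝ := -Real.log a with hσ
  have hσa : Real.exp (-σ) = a := by rw [hσ, neg_neg, Real.exp_log ha]
  have h1 : ∀ᵐ x : ℝ, x ∈ Ioo 0 (b / a) →
      (scalingUnitary σ h : ℝ → ℂ) x = (Real.exp (-σ / 2) : ℂ) * c :=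
    scalingUnitary_ae_const_Ioo_scale hc (by rw [hσa, div_mul_cancel₀ b ha.ne'])
  have hwb' : ∀ τ, w τ ≠ 0 → Real.exp (-τ) ≤ b / a := fun τ hτ ↦ by
    rw [le_div_iff₀ ha, mul_comm]; exact hwb τ hτ
  have key := rightMellin_scalingOp hw hws hwb' h1 hs1 hs2
  rw [← scalingUnitary_scalingOp_comm hwi, rightMellin_scalingUnitary,
    rightMellin_scalingUnitary] at key
  have hne : cexp ((σ : ℂ) * (1 / 2 - s)) ≠ 0 := Complex.exp_ne_zero _
  apply mul_left_cancel₀ hne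
  rw [key]
  ring

/-! ## B. `ϑ(w)v ∈ K_a` for `v ∈ L_1` and a weight supported in `[log a, −log a]` with
`Θ_w(0) = Θ_w(1) = 0` -/

/-- For `|τ| ≤ −log a` (`a > 0`): `a e^{−τ} ≤ 1`. [folklore] -/
private theorem mul_exp_neg_le_one {a τ : ℝ} (ha : 0 < a) (hτ : |τ| ≤ -Real.log a) :
    a * Real.exp (-τ) ≤ 1 := by
  have h1 : Real.exp (-τ) ≤ a⁻¹ := by
    calc Real.exp (-τ) ≤ Real.exp (-Real.log a) := Real.exp_le_exp.2 ((neg_le_abs τ).trans hτ)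
      _ = a⁻¹ := by rw [Real.exp_neg, Real.exp_log ha]
  calc a * Real.exp (-τ) ≤ a * a⁻¹ := by gcongr
    _ = 1 := mul_inv_cancel₀ ha.ne'

/-- **`ϑ(w)v ∈ K_a`** for `v ∈ L_1` (`v` and `𝓕v` constant on `(0,1)`) and a continuous weight `w`
supported in `[log a, −log a]` with `∫ w(τ)e^{−τ/2}dτ = 0` (`Θ_w(1) = 0`) and `∫ w(−τ)e^{−τ/2}dτ = 0`
(`Θ_w(0) = 0`): `ϑ(w)v` is even, equals `c·Θ_w(1) = 0` on `(0,a)`, and `𝓕(ϑ(w)v) = ϑ(w(−·))𝓕v`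
equals `c′·Θ_w(0) = 0` on `(0,a)` — print's "`G(s) = s(s−1)θ̂(s)ζ(s)` … is the right Mellin
transform of a (non-zero) element `g` of `K_a`", the factor `s(s−1)` killing both constants.
[cite: Burnol2004b, proof of Thm. 6.7 (arXiv:math/0203120v7 p. 17, TeX l.1345–1362)] -/
theorem scalingOp_mem_sonineK {w : ℝ → ℂ} (hw : Continuous w) (hws : HasCompactSupport w)
    {a : ℝ} (ha : 0 < a) (hwa : ∀ τ, w τ ≠ 0 → |τ| ≤ -Real.log a)
    (h1 : ∫ τ : ℝ, w τ * (Real.exp (-τ / 2) : ℂ) = 0)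
    (h0 : ∫ τ : ℝ, w (-τ) * (Real.exp (-τ / 2) : ℂ) = 0)
    {v : Lp ℂ 2 (volume : Measure ℝ)} (hv : v ∈ sonineL 1) : scalingOp w v ∈ sonineK a := by
  have hwi : Integrable w := hw.integrable_of_hasCompactSupport hws
  obtain ⟨heven, ⟨c, hc⟩, ⟨c', hc'⟩⟩ := hv
  refine ⟨scalingOp_mem_evenPart hwi heven, ?_, ?_⟩
  · have h := scalingOp_ae_const_Ioo_scale hwi ha (b := 1)
      (fun τ hτ ↦ mul_exp_neg_le_one ha (hwa τ hτ)) hc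
    filter_upwards [h] with x hx hxa
    rw [hx hxa, h1, mul_zero]
  · rw [fourier_scalingOp hwi]
    have h := scalingOp_ae_const_Ioo_scale hwi.comp_neg ha (b := 1)
      (fun τ hτ ↦ mul_exp_neg_le_one ha (by simpa only [abs_neg] using hwa (-τ) hτ)) hc'
    filter_upwards [h] with x hx hxa
    rw [hx hxa, h0, mul_zero]

/-! ## C. The weight: `Θ_w(0) = Θ_w(1) = 0 ≠ Θ_w(ρ)`, support in `[−L, L]`

Print: "if `P(s)` is an arbitrary polynomial, then `P(s)θ̂(s) = θ̂_P(s)` for a certain smooth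
function `θ_P`, again supported in `[a,A]`" with `P(s) = s(s−1)`, and "`θ̂(ρ) ≠ 0`, which obviously
may always be arranged". In the additive avatar `Θ_w(s) = ∫ w(τ)e^{τ(1/2−s)}dτ` is the tree's
`weilMellin w (1 − s)`, and `w = ψ″ − ψ/4` gives `Θ_w(s) = s(s−1)Θ_ψ(s)` (`weilMellin_deriv_deriv`). -/

/-- `Θ_w(s) = weilMellin w (1 − s)` (the tree's additive Mellin–Laplace transform
`ĝ(s) = ∫ g(t)e^{(s−1/2)t}dt`). [cite: Burnol2004b, proof of Thm. 4.9 (arXiv:math/0203120v7 p. 11, TeX l.912–917)] -/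
theorem mollMultiplier_eq_weilMellin (w : ℝ → ℂ) (s : ℂ) :
    (∫ τ : ℝ, w τ * cexp ((τ : ℂ) * (1 / 2 - s))) = weilMellin w (1 - s) := by
  unfold weilMellin
  congr 1
  funext τ
  congr 1
  ring_nf

/-- **The weight.** For `L > 0` and `ρ ≠ 0, 1` there is a continuous (indeed smooth) compactly
supported `w : ℝ → ℂ` living on `|τ| ≤ L` with `∫ w(τ)e^{−τ/2}dτ = 0` (`Θ_w(1) = 0`),
`∫ w(−τ)e^{−τ/2}dτ = 0` (`Θ_w(0) = 0`) and `Θ_w(ρ) ≠ 0`: `w = ψ″ − ψ/4`, `ψ(τ) = b(τ)e^{τ(1/2−ρ̄)}` with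
`b` a smooth bump at `0` of outer radius `L`, so that `Θ_w(s) = s(s−1)Θ_ψ(s)` and
`Θ_ψ(ρ) = ∫ b(τ)e^{τ(1−2Re ρ)}dτ > 0`. [cite: Burnol2004b, proof of Thm. 6.7 (arXiv:math/0203120v7 p. 17, TeX l.1345–1352, 1363–1366)] -/
theorem exists_weight {L : ℝ} (hL : 0 < L) {ρ : ℂ} (hρ0 : ρ ≠ 0) (hρ1 : ρ ≠ 1) :
    ∃ w : ℝ → ℂ, Continuous w ∧ HasCompactSupport w ∧ (∀ τ, w τ ≠ 0 → |τ| ≤ L) ∧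
      (∫ τ : ℝ, w τ * (Real.exp (-τ / 2) : ℂ)) = 0 ∧
      (∫ τ : ℝ, w (-τ) * (Real.exp (-τ / 2) : ℂ)) = 0 ∧
      (∫ τ : ℝ, w τ * cexp ((τ : ℂ) * (1 / 2 - ρ))) ≠ 0 := by
  let b : ContDiffBump (0 : ℝ) := ⟨L / 2, L, by positivity, by linarith⟩
  set ψ : ℝ → ℂ := fun τ ↦ ((b τ : ℝ) : ℂ) * cexp ((τ : ℂ) * (1 / 2 - conj ρ)) with hψdef
  have hψc : ContDiff ℝ ∞ ψ := by
    refine (Complex.ofRealCLM.contDiff.comp b.contDiff).mul ?_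
    exact Complex.contDiff_exp.comp (Complex.ofRealCLM.contDiff.mul contDiff_const)
  have hψs : HasCompactSupport ψ :=
    (b.hasCompactSupport.comp_left Complex.ofReal_zero).mul_right
  have hψW : IsWeilTest ψ := ⟨hψc, hψs⟩
  -- support of `ψ`
  have htsψ : tsupport ψ ⊆ Metric.closedBall (0 : ℝ) L := by
    rw [← b.tsupport_eq]
    refine closure_mono fun τ hτ ↦ ?_
    rw [Function.mem_support] at hτ ⊢
    intro hb0
    apply hτ
    simp only [hψdef, hb0, Complex.ofReal_zero, zero_mul]
  -- the weight `w = ψ″ − ψ/4`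
  set w : ℝ → ℂ := deriv (deriv ψ) + fun τ ↦ (-(1 / 4) : ℂ) * ψ τ with hwdef
  have hw2 : IsWeilTest (deriv (deriv ψ)) := hψW.deriv.deriv
  have hw4 : IsWeilTest (fun τ ↦ (-(1 / 4) : ℂ) * ψ τ) := hψW.const_mul _
  have hwW : IsWeilTest w := hw2.add hw4
  -- `Θ_w = s(s−1)Θ_ψ`, in `weilMellin` form
  have hΘ : ∀ z : ℂ, weilMellin w z = ((z - 1 / 2) ^ 2 - 1 / 4) * weilMellin ψ z := by
    intro z
    rw [hwdef, weilMellin_add hw2.1.continuous hw2.2 hw4.1.continuous hw4.2,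
      weilMellin_deriv_deriv hψW, weilMellin_const_mul]
    ring
  -- `Θ_ψ(ρ) = ∫ b(τ) e^{τ(1 − 2 Re ρ)} dτ > 0`
  have hpos : weilMellin ψ (1 - ρ) ≠ 0 := by
    set F : ℝ → ℝ := fun τ ↦ b τ * Real.exp (τ * (1 - 2 * ρ.re)) with hF
    have hint : weilMellin ψ (1 - ρ) = ((∫ τ : ℝ, F τ : ℝ) : ℂ) := by
      unfold weilMellin
      rw [← integral_complex_ofReal]
      congr 1
      funext τ
      have he : (τ : ℂ) * (1 / 2 - conj ρ) + (1 - ρ - 1 / 2) * (τ : ℂ) =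
          ((τ * (1 - 2 * ρ.re) : ℝ) : ℂ) := by
        apply Complex.ext
        · simp [Complex.mul_re]
          ring
        · simp [Complex.mul_im]
          ring
      simp only [hψdef, hF]
      rw [mul_assoc, ← Complex.exp_add, he, ← Complex.ofReal_exp, ← Complex.ofReal_mul]
    rw [hint, Complex.ofReal_ne_zero]
    have hFc : Continuous F := by
      have hb := b.continuous
      simp only [hF]
      fun_prop
    have hFsupp : HasCompactSupport F := by
      simp only [hF]
      exact b.hasCompactSupport.mul_right
    have hFnn : 0 ≤ F := fun τ ↦ mul_nonneg (b.nonneg' τ) (Real.exp_pos _).le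
    have hF0 : F 0 ≠ 0 := by
      have hb0 : b 0 = 1 := b.one_of_mem_closedBall (by simp [b]; positivity)
      simp [hF, hb0]
    exact (hFc.integral_pos_of_hasCompactSupport_nonneg_nonzero hFsupp hFnn hF0).ne'
  refine ⟨w, hwW.1.continuous, hwW.2, ?_, ?_, ?_, ?_⟩
  · -- support of `w`
    intro τ hτ
    by_contra hlt
    rw [not_le] at hlt
    have hτ' : τ ∉ tsupport ψ := fun h ↦ by
      have := htsψ h
      rw [Metric.mem_closedBall, dist_zero_right, Real.norm_eq_abs] at this
      linarith
    have h2 : deriv (deriv ψ) τ = 0 :=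
      image_eq_zero_of_notMem_tsupport fun h ↦ hτ' (tsupport_deriv_subset (tsupport_deriv_subset h))
    have h3 : ψ τ = 0 := image_eq_zero_of_notMem_tsupport hτ'
    apply hτ
    simp only [hwdef, Pi.add_apply, h2, h3, mul_zero, add_zero]
  · -- `Θ_w(1) = 0`
    have e1 : (∫ τ : ℝ, w τ * (Real.exp (-τ / 2) : ℂ)) = weilMellin w 0 := by
      unfold weilMellin
      congr 1
      funext τ
      congr 1
      rw [Complex.ofReal_exp]
      congr 1
      push_cast
      ring
    rw [e1, hΘ]
    norm_num
  · -- `Θ_w(0) = 0`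
    have e0 : (∫ τ : ℝ, w (-τ) * (Real.exp (-τ / 2) : ℂ)) = weilMellin w 1 := by
      have hneg := integral_neg_eq_self (fun τ : ℝ ↦ w τ * (Real.exp (τ / 2) : ℂ)) volume
      have hre : (fun τ : ℝ ↦ w (-τ) * (Real.exp (-τ / 2) : ℂ)) =
          fun τ : ℝ ↦ (fun u : ℝ ↦ w u * (Real.exp (u / 2) : ℂ)) (-τ) := by
        funext τ
        simp only [neg_div]
      rw [hre, hneg]
      unfold weilMellin
      congr 1
      funext τ
      congr 1
      rw [Complex.ofReal_exp]
      congr 1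
      push_cast
      ring
    rw [e0, hΘ]
    norm_num
  · -- `Θ_w(ρ) ≠ 0`
    rw [mollMultiplier_eq_weilMellin, hΘ]
    refine mul_ne_zero ?_ hpos
    have : ((1 : ℂ) - ρ - 1 / 2) ^ 2 - 1 / 4 = ρ * (ρ - 1) := by ring
    rw [this]
    exact mul_ne_zero hρ0 (sub_ne_zero.2 hρ1)

/-! ## D. The dual family `g_{ρ,l} = ϑ(w)v_{ρ,l}` and its pairings with the evaluators `Z^a_{ρ′,k}`

`v_{ρ,l} = zetaQuotientVector ρ l ∈ L_1` (`1 ≤ l ≤ m_ρ`) is the inverse Mellin transform of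
`ζ(s)/(s−ρ)^l` (Prop. 4.2); `g_{ρ,l} := ϑ(w)v_{ρ,l} ∈ K_a` has continued transform
`Θ_w(s)ζ(s)/(s−ρ)^l` — print's "`G(s)/(s−ρ)`" (up to the harmless factor `Θ_ψ/θ̂`). -/

/-- **The continued right Mellin transform of `g_{ρ,l} = ϑ(w)v_{ρ,l}` is `Θ_w(s)·ζ(s)/(s−ρ)^l` on
`ℂ ∖ {1}`** (on the strip by `rightMellin_scalingOp_scale` and the defining property of `v_{ρ,l}`;
everywhere by uniqueness of the continuation). [cite: Burnol2004b, proof of Thm. 6.7 (arXiv:math/0203120v7 p. 17, TeX l.1363–1368)] -/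
theorem rightMellinExt_scalingOp_zetaQuotientVector {a : ℝ} (ha : 0 < a) {w : ℝ → ℂ}
    (hw : Continuous w) (hws : HasCompactSupport w) (hwa : ∀ τ, w τ ≠ 0 → |τ| ≤ -Real.log a)
    {ρ : ℂ} (hρ : ρ ∈ ZetaZeros.riemannZetaNontrivialZeros) {l : ℕ} (hl : 1 ≤ l)
    (hlm : (l : ℤ) ≤ riemannZetaZeroOrder ρ) :
    EqOn (rightMellinExt (scalingOp w (zetaQuotientVector ρ l) : ℝ → ℂ))
      (fun s ↦ (∫ τ : ℝ, w τ * cexp ((τ : ℂ) * (1 / 2 - s))) * zetaOverPow ρ l s) {s | s ≠ 1} := by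
  have hv := isZetaQuotientVector_zetaQuotientVector hρ hl hlm
  have hρ1 : ρ ≠ 1 := (admissible_of_mem_nontrivialZeros hρ).2.1
  have hord := natCast_le_analyticOrderAt_zeta hρ1 hlm
  obtain ⟨-, ⟨c, hc⟩, -⟩ := hv.1
  have hG' : HasRightMellinContinuation (scalingOp w (zetaQuotientVector ρ l) : ℝ → ℂ)
      (fun s ↦ (∫ τ : ℝ, w τ * cexp ((τ : ℂ) * (1 / 2 - s))) * zetaOverPow ρ l s) := by
    refine ⟨(differentiable_mollMultiplier hw hws).differentiableOn.mul
      (differentiableOn_zetaOverPow hρ1 hord), fun s hs1 hs2 ↦ ?_⟩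
    dsimp only
    rw [rightMellin_scalingOp_scale hw hws ha (b := 1)
      (fun τ hτ ↦ mul_exp_neg_le_one ha (hwa τ hτ)) hc hs1 hs2, hv.2 s hs1 hs2]
  exact (hasRightMellinContinuation_rightMellinExt ⟨_, hG'⟩).eqOn hG'

/-- **`[g_{ρ,l}, Z^a_{ρ′,k}] = (d/ds)^k[Θ_w(s)Γ_ℝ(s)ζ(s)/(s−ρ)^l]_{s=ρ′}`** for non-trivial zeros
`ρ, ρ′`, `1 ≤ l ≤ m_ρ` and every `k`: the evaluator `Z^a_{ρ′,k}` EXISTS and evaluates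
`M(·)^{(k)}(ρ′)` on `K_a` (`BurnolEvaluators.isBurnolZ_burnolZ`), and `g_{ρ,l} ∈ K_a`.
[cite: Burnol2004b, proof of Thm. 6.7 (arXiv:math/0203120v7 p. 17, TeX l.1366–1370)] -/
theorem pairing_eq_iteratedDeriv {a : ℝ} (ha : 0 < a) {w : ℝ → ℂ} (hw : Continuous w)
    (hws : HasCompactSupport w) (hwa : ∀ τ, w τ ≠ 0 → |τ| ≤ -Real.log a)
    (h1 : ∫ τ : ℝ, w τ * (Real.exp (-τ / 2) : ℂ) = 0)
    (h0 : ∫ τ : ℝ, w (-τ) * (Real.exp (-τ / 2) : ℂ) = 0)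
    {ρ : ℂ} (hρ : ρ ∈ ZetaZeros.riemannZetaNontrivialZeros) {l : ℕ} (hl : 1 ≤ l)
    (hlm : (l : ℤ) ≤ riemannZetaZeroOrder ρ) {ρ' : ℂ}
    (hρ' : ρ' ∈ ZetaZeros.riemannZetaNontrivialZeros) (k : ℕ) :
    ∫ t in Ioi (0 : ℝ), (scalingOp w (zetaQuotientVector ρ l) : ℝ → ℂ) t * burnolZ a ρ' k t =
      iteratedDeriv k (fun s ↦ (∫ τ : ℝ, w τ * cexp ((τ : ℂ) * (1 / 2 - s))) *
        (Gammaℝ s * zetaOverPow ρ l s)) ρ' := by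
  obtain ⟨h0', h1', hn⟩ := admissible_of_mem_nontrivialZeros hρ'
  have hK : scalingOp w (zetaQuotientVector ρ l) ∈ sonineK a :=
    scalingOp_mem_sonineK hw hws ha hwa h1 h0 (isZetaQuotientVector_zetaQuotientVector hρ hl hlm).1
  rw [(isBurnolZ_burnolZ ha h0' h1' hn k).2 _ hK]
  simp only [burnolEval]
  apply Filter.EventuallyEq.iteratedDeriv_eq
  filter_upwards [isOpen_ne.mem_nhds h1'] with s hs
  simp only [completedMellin]
  rw [rightMellinExt_scalingOp_zetaQuotientVector ha hw hws hwa hρ hl hlm hs]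
  ring

/-- `Θ_w(s)Γ_ℝ(s)ζ(s)/(s−ρ)^l` (filled in) is analytic at every non-trivial zero `ρ′` (`Θ_w` is
entire). [cite: Burnol2004b, proof of Thm. 6.7 (arXiv:math/0203120v7 p. 17, TeX l.1366–1370)] -/
theorem analyticAt_mollifiedQuotient {w : ℝ → ℂ} (hw : Continuous w) (hws : HasCompactSupport w)
    {ρ ρ' : ℂ} (hρ : ρ ∈ ZetaZeros.riemannZetaNontrivialZeros) {l : ℕ}
    (hlm : (l : ℤ) ≤ riemannZetaZeroOrder ρ) (hρ' : ρ' ∈ ZetaZeros.riemannZetaNontrivialZeros) :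
    AnalyticAt ℂ (fun s ↦ (∫ τ : ℝ, w τ * cexp ((τ : ℂ) * (1 / 2 - s))) *
      (Gammaℝ s * zetaOverPow ρ l s)) ρ' :=
  ((differentiable_mollMultiplier hw hws).analyticAt ρ').mul (analyticAt_completedQuotient hρ hlm hρ')

/-- Orders only grow under the extra entire factor `Θ_w`:
`ord_{ρ′}(Γ_ℝζ/(s−ρ)^l) ≤ ord_{ρ′}(Θ_w·Γ_ℝζ/(s−ρ)^l)`. [cite: Burnol2004b, proof of Thm. 6.7 (arXiv:math/0203120v7 p. 17, TeX l.1366–1370)] -/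
theorem le_analyticOrderAt_mollifiedQuotient {w : ℝ → ℂ} (hw : Continuous w)
    (hws : HasCompactSupport w) {ρ ρ' : ℂ} (hρ : ρ ∈ ZetaZeros.riemannZetaNontrivialZeros) {l : ℕ}
    (hlm : (l : ℤ) ≤ riemannZetaZeroOrder ρ) (hρ' : ρ' ∈ ZetaZeros.riemannZetaNontrivialZeros) :
    analyticOrderAt (fun s ↦ Gammaℝ s * zetaOverPow ρ l s) ρ' ≤
      analyticOrderAt (fun s ↦ (∫ τ : ℝ, w τ * cexp ((τ : ℂ) * (1 / 2 - s))) *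
        (Gammaℝ s * zetaOverPow ρ l s)) ρ' := by
  have hΘ : AnalyticAt ℂ (fun s : ℂ ↦ ∫ τ : ℝ, w τ * cexp ((τ : ℂ) * (1 / 2 - s))) ρ' :=
    (differentiable_mollMultiplier hw hws).analyticAt ρ'
  have hQ := analyticAt_completedQuotient hρ hlm hρ'
  have e : (fun s ↦ (∫ τ : ℝ, w τ * cexp ((τ : ℂ) * (1 / 2 - s))) *
      (Gammaℝ s * zetaOverPow ρ l s)) =
      (fun s : ℂ ↦ ∫ τ : ℝ, w τ * cexp ((τ : ℂ) * (1 / 2 - s))) *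
        fun s ↦ Gammaℝ s * zetaOverPow ρ l s := rfl
  rw [e, analyticOrderAt_mul hΘ hQ]
  exact le_add_self

/-- **Order at `ρ′ = ρ`**: if `Θ_w(ρ) ≠ 0` then `Θ_w(s)Γ_ℝ(s)ζ(s)/(s−ρ)^l` vanishes at `ρ` to order
EXACTLY `m_ρ − l` (`Γ_ℝ(ρ) ≠ 0`, `Θ_w(ρ) ≠ 0`: print's "`θ̂(ρ) ≠ 0`").
[cite: Burnol2004b, proof of Thm. 6.7 (arXiv:math/0203120v7 p. 17, TeX l.1363–1370)] -/
theorem analyticOrderAt_mollifiedQuotient_self {w : ℝ → ℂ} (hw : Continuous w)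
    (hws : HasCompactSupport w) {ρ : ℂ} (hρ : ρ ∈ ZetaZeros.riemannZetaNontrivialZeros)
    (hΘρ : (∫ τ : ℝ, w τ * cexp ((τ : ℂ) * (1 / 2 - ρ))) ≠ 0) {l : ℕ} (hl : 1 ≤ l)
    (hlm : (l : ℤ) ≤ riemannZetaZeroOrder ρ) :
    analyticOrderAt (fun s ↦ (∫ τ : ℝ, w τ * cexp ((τ : ℂ) * (1 / 2 - s))) *
        (Gammaℝ s * zetaOverPow ρ l s)) ρ =
      (((riemannZetaZeroOrder ρ).toNat - l : ℕ) : ℕ∞) := by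
  have hΘ : AnalyticAt ℂ (fun s : ℂ ↦ ∫ τ : ℝ, w τ * cexp ((τ : ℂ) * (1 / 2 - s))) ρ :=
    (differentiable_mollMultiplier hw hws).analyticAt ρ
  have hQ := analyticAt_completedQuotient hρ hlm hρ
  have e : (fun s ↦ (∫ τ : ℝ, w τ * cexp ((τ : ℂ) * (1 / 2 - s))) *
      (Gammaℝ s * zetaOverPow ρ l s)) =
      (fun s : ℂ ↦ ∫ τ : ℝ, w τ * cexp ((τ : ℂ) * (1 / 2 - s))) *
        fun s ↦ Gammaℝ s * zetaOverPow ρ l s := rfl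
  rw [e, analyticOrderAt_mul hΘ hQ, (hΘ.analyticOrderAt_eq_zero).2 hΘρ, zero_add,
    analyticOrderAt_completedQuotient_self hρ hl hlm]

/-- **`[g_{ρ,l}, Z^a_{ρ,k}] = 0` for `k + l < m_ρ`** (below the order at `ρ′ = ρ`).
[cite: Burnol2004b, proof of Thm. 6.7 (arXiv:math/0203120v7 p. 17, TeX l.1366–1372)] -/
theorem pairing_self_eq_zero {a : ℝ} (ha : 0 < a) {w : ℝ → ℂ} (hw : Continuous w)
    (hws : HasCompactSupport w) (hwa : ∀ τ, w τ ≠ 0 → |τ| ≤ -Real.log a)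
    (h1 : ∫ τ : ℝ, w τ * (Real.exp (-τ / 2) : ℂ) = 0)
    (h0 : ∫ τ : ℝ, w (-τ) * (Real.exp (-τ / 2) : ℂ) = 0)
    {ρ : ℂ} (hρ : ρ ∈ ZetaZeros.riemannZetaNontrivialZeros) {l : ℕ} (hl : 1 ≤ l)
    (hlm : l ≤ (riemannZetaZeroOrder ρ).toNat) {k : ℕ}
    (hk : k + l < (riemannZetaZeroOrder ρ).toNat) :
    ∫ t in Ioi (0 : ℝ), (scalingOp w (zetaQuotientVector ρ l) : ℝ → ℂ) t * burnolZ a ρ k t = 0 := by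
  have hlm' : (l : ℤ) ≤ riemannZetaZeroOrder ρ := by omega
  rw [pairing_eq_iteratedDeriv ha hw hws hwa h1 h0 hρ hl hlm' hρ k]
  have hΛ := analyticAt_mollifiedQuotient hw hws hρ hlm' hρ
  have hord : (((riemannZetaZeroOrder ρ).toNat - l : ℕ) : ℕ∞) ≤
      analyticOrderAt (fun s ↦ (∫ τ : ℝ, w τ * cexp ((τ : ℂ) * (1 / 2 - s))) *
        (Gammaℝ s * zetaOverPow ρ l s)) ρ := by
    rw [← analyticOrderAt_completedQuotient_self hρ hl hlm']
    exact le_analyticOrderAt_mollifiedQuotient hw hws hρ hlm' hρ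
  exact (natCast_le_analyticOrderAt_iff_iteratedDeriv_eq_zero hΛ).1 hord k (by omega)

/-- **`[g_{ρ,l}, Z^a_{ρ,k}] ≠ 0` for `k + l = m_ρ`** (AT the order at `ρ′ = ρ`, given `Θ_w(ρ) ≠ 0`) —
print's "to which it is not perpendicular". [cite: Burnol2004b, proof of Thm. 6.7 (arXiv:math/0203120v7 p. 17, TeX l.1366–1372)] -/
theorem pairing_self_ne_zero {a : ℝ} (ha : 0 < a) {w : ℝ → ℂ} (hw : Continuous w)
    (hws : HasCompactSupport w) (hwa : ∀ τ, w τ ≠ 0 → |τ| ≤ -Real.log a)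
    (h1 : ∫ τ : ℝ, w τ * (Real.exp (-τ / 2) : ℂ) = 0)
    (h0 : ∫ τ : ℝ, w (-τ) * (Real.exp (-τ / 2) : ℂ) = 0)
    {ρ : ℂ} (hρ : ρ ∈ ZetaZeros.riemannZetaNontrivialZeros)
    (hΘρ : (∫ τ : ℝ, w τ * cexp ((τ : ℂ) * (1 / 2 - ρ))) ≠ 0) {l : ℕ} (hl : 1 ≤ l)
    (hlm : l ≤ (riemannZetaZeroOrder ρ).toNat) {k : ℕ}
    (hk : k + l = (riemannZetaZeroOrder ρ).toNat) :
    ∫ t in Ioi (0 : ℝ), (scalingOp w (zetaQuotientVector ρ l) : ℝ → ℂ) t * burnolZ a ρ k t ≠ 0 := by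
  have hlm' : (l : ℤ) ≤ riemannZetaZeroOrder ρ := by omega
  rw [pairing_eq_iteratedDeriv ha hw hws hwa h1 h0 hρ hl hlm' hρ k]
  have hΛ := analyticAt_mollifiedQuotient hw hws hρ hlm' hρ
  have hord := analyticOrderAt_mollifiedQuotient_self hw hws hρ hΘρ hl hlm'
  rw [show (riemannZetaZeroOrder ρ).toNat - l = k by omega] at hord
  exact ((analyticOrderAt_eq_nat_iff_iteratedDeriv_eq_zero hΛ).1 hord).2

/-- **`[g_{ρ,l}, Z^a_{ρ′,k}] = 0` for `ρ′ ≠ ρ`, `k < m_{ρ′}`** — print's "perpendicular … to all the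
evaluators except" those at `ρ`. [cite: Burnol2004b, proof of Thm. 6.7 (arXiv:math/0203120v7 p. 17, TeX l.1366–1372)] -/
theorem pairing_of_ne_eq_zero {a : ℝ} (ha : 0 < a) {w : ℝ → ℂ} (hw : Continuous w)
    (hws : HasCompactSupport w) (hwa : ∀ τ, w τ ≠ 0 → |τ| ≤ -Real.log a)
    (h1 : ∫ τ : ℝ, w τ * (Real.exp (-τ / 2) : ℂ) = 0)
    (h0 : ∫ τ : ℝ, w (-τ) * (Real.exp (-τ / 2) : ℂ) = 0)
    {ρ : ℂ} (hρ : ρ ∈ ZetaZeros.riemannZetaNontrivialZeros) {l : ℕ} (hl : 1 ≤ l)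
    (hlm : (l : ℤ) ≤ riemannZetaZeroOrder ρ) {ρ' : ℂ}
    (hρ' : ρ' ∈ ZetaZeros.riemannZetaNontrivialZeros) (hne : ρ' ≠ ρ) {k : ℕ}
    (hk : k < (riemannZetaZeroOrder ρ').toNat) :
    ∫ t in Ioi (0 : ℝ), (scalingOp w (zetaQuotientVector ρ l) : ℝ → ℂ) t * burnolZ a ρ' k t = 0 := by
  rw [pairing_eq_iteratedDeriv ha hw hws hwa h1 h0 hρ hl hlm hρ' k]
  have hΛ := analyticAt_mollifiedQuotient hw hws hρ hlm hρ'
  have hord : ((riemannZetaZeroOrder ρ').toNat : ℕ∞) ≤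
      analyticOrderAt (fun s ↦ (∫ τ : ℝ, w τ * cexp ((τ : ℂ) * (1 / 2 - s))) *
        (Gammaℝ s * zetaOverPow ρ l s)) ρ' := by
    rw [← analyticOrderAt_completedQuotient_of_ne (ρ := ρ) (l := l) hρ' hne]
    exact le_analyticOrderAt_mollifiedQuotient hw hws hρ hlm hρ'
  exact (natCast_le_analyticOrderAt_iff_iteratedDeriv_eq_zero hΛ).1 hord k hk

/-! ## E. Thm. 6.7: minimality of the `Z^a_{ρ,k}` in `K_a`, `a < 1` -/

/-- **Burnol 2004b, Thm. 6.7: for `0 < a < 1` the system `(Z^a_{ρ,k})`, `ρ` a non-trivial zero,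
`0 ≤ k < m_ρ`, is MINIMAL in `K_a`.** For the index `(ρ, k₀)`: with the weight `w` of `exists_weight`
(`L = −log a > 0`), the continuous functionals `[g_{ρ,l}, ·]`, `1 ≤ l ≤ m_ρ`, and the vectors `Z^a_{ρ,k}`,
`k < m_ρ`, are in triangular duality (`pairing_self_eq_zero` / `pairing_self_ne_zero`), so the
triangular inversion `BurnolZetaMinimal.exists_dual_functional` gives `ψ` with `ψ(Z^a_{ρ,k₀}) ≠ 0`,
`ψ(Z^a_{ρ,k}) = 0` (`k ≠ k₀`) and `ψ(Z^a_{ρ″,k}) = 0` for `ρ″ ≠ ρ` (`pairing_of_ne_eq_zero`); `ψ` is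
continuous and kills the closed span of the other evaluators — "So `Z^a_{ρ,0}` can not be in the closed
span of the others. The proof is easily extended to the case of a multiple zero."
[cite: Burnol2004b, Thm. 6.7 (arXiv:math/0203120v7 p. 17, TeX l.1340–1375)] -/
theorem isMinimalSystem_burnolZSystem {a : ℝ} (ha : 0 < a) (ha1 : a < 1) :
    IsMinimalSystem (burnolZSystem a) := by
  intro q₀ hmem
  obtain ⟨⟨ρ, k₀⟩, hρ, hk₀⟩ := q₀
  simp only at hρ hk₀ hmem
  set m := (riemannZetaZeroOrder ρ).toNat with hm
  have hk₀m : k₀ + 1 ≤ m := by omega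
  obtain ⟨hρ0, hρ1, -⟩ := admissible_of_mem_nontrivialZeros hρ
  -- the weight for `ρ`, living on `|τ| ≤ −log a`
  have hL : 0 < -Real.log a := neg_pos.2 (Real.log_neg ha ha1)
  obtain ⟨w, hw, hws, hwa, hΘ1, hΘ0, hΘρ⟩ := exists_weight hL hρ0 hρ1
  -- the functionals `[g_{ρ,i+1}, ·]`, `i ∈ ℕ`
  choose T hT using fun i : ℕ ↦
    exists_leftPairingCLM (scalingOp w (zetaQuotientVector ρ (i + 1)))
  -- vectors `Z^a_{ρ,j-1}`, `1 ≤ j ≤ m`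
  have h0 : ∀ i j, 1 ≤ j → j ≤ m → i + j < m → T i (burnolZ a ρ (j - 1)) = 0 := by
    intro i j hj hjm hij
    rw [hT]
    exact pairing_self_eq_zero ha hw hws hwa hΘ1 hΘ0 hρ (l := i + 1) (by omega) (by omega)
      (by omega)
  have h1 : ∀ i j, 1 ≤ j → j ≤ m → i + j = m → T i (burnolZ a ρ (j - 1)) ≠ 0 := by
    intro i j hj hjm hij
    rw [hT]
    exact pairing_self_ne_zero ha hw hws hwa hΘ1 hΘ0 hρ hΘρ (l := i + 1) (by omega) (by omega)
      (by omega)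
  obtain ⟨ψ, hψ0, hψ1, hψ2⟩ :=
    exists_dual_functional T (fun j ↦ burnolZ a ρ (j - 1)) m h0 h1 (k₀ + 1) (by omega) hk₀m
  simp only [Nat.add_sub_cancel] at hψ0
  -- `ψ` kills every other evaluator
  have hker : ∀ r : ZetaZeroIndex, r ≠ ⟨(ρ, k₀), hρ, hk₀⟩ → ψ (burnolZSystem a r) = 0 := by
    intro r hr
    obtain ⟨⟨ρr, kr⟩, hρr, hkr⟩ := r
    show ψ (burnolZ a ρr kr) = 0
    by_cases heq : ρr = ρ
    · subst heq
      have hne : kr + 1 ≠ k₀ + 1 := by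
        intro h
        apply hr
        have : kr = k₀ := by omega
        subst this
        rfl
      have h := hψ1 (kr + 1) (by omega) (by simp only at hkr; omega) hne
      simpa only [Nat.add_sub_cancel] using h
    · refine hψ2 _ fun i hi ↦ ?_
      rw [hT]
      exact pairing_of_ne_eq_zero ha hw hws hwa hΘ1 hΘ0 hρ (l := i + 1) (by omega)
        (by push_cast; omega) hρr heq (by simp only at hkr ⊢; omega)
  -- the closed span of the others lies in `ker ψ`
  have hspan : (Submodule.span ℂ (burnolZSystem a '' {j | j ≠ ⟨(ρ, k₀), hρ, hk₀⟩}) :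
      Set (Lp ℂ 2 (volume : Measure ℝ))) ⊆ {x | ψ x = 0} := by
    have : Submodule.span ℂ (burnolZSystem a '' {j | j ≠ ⟨(ρ, k₀), hρ, hk₀⟩}) ≤
        LinearMap.ker (ψ : Lp ℂ 2 (volume : Measure ℝ) →ₗ[ℂ] ℂ) := by
      refine Submodule.span_le.2 ?_
      rintro x ⟨r, hr, rfl⟩
      exact hker r hr
    intro x hx
    exact this hx
  have hcl : closure (Submodule.span ℂ (burnolZSystem a '' {j | j ≠ ⟨(ρ, k₀), hρ, hk₀⟩}) :
      Set (Lp ℂ 2 (volume : Measure ℝ))) ⊆ {x | ψ x = 0} :=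
    closure_minimal hspan (isClosed_singleton.preimage ψ.continuous)
  exact hψ0 (hcl hmem)

end BurnolZEvaluatorsMinimal

/-- **Burnol 2004b, Thm. 6.7 — DISCHARGE of the named fact `Burnol2004b_thm6_7`: "Let `a < 1`. The
vectors `Z^a_{ρ,k}` are minimal in `K_a`."** Printed proof (TeX l.1345–1375: mollified zeta-quotient
vectors of Prop. 4.2) followed, with the multiple-zero case closed by the triangular inversion of
Thm. 3.3 instead of §7. RH-FREE; bears_on B-C/B-P (COLUMN 6 DBR); nothing here bears on the truth of
RH.
[cite: Burnol2004b, Thm. 6.7 (arXiv:math/0203120v7 p. 17, TeX l.1340–1375)] -/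
theorem Burnol2004b_thm6_7_holds : Burnol2004b_thm6_7 :=
  fun _ ha ha1 ↦ BurnolZEvaluatorsMinimal.isMinimalSystem_burnolZSystem ha ha1

/-! ## F. Consequences for Thm. 3.2 ("The three theorems 3.1, 3.2, 3.3 are thus established") -/

/-- **Burnol 2004b, Thm. 3.2, the clause `a < 1`** (first conjunct of `Burnol2004b_thm3_2 a`, verbatim
and hypothesis-free): "The vectors `Z^a_{ρ,k}`, `0 ≤ k < m_ρ`, are a minimal, but not complete, system
for `a < 1`" — minimal by Thm. 6.7 (`Burnol2004b_thm6_7_holds`), not complete because the non-zero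
co-Poisson vectors of `K_a` are `[·,·]`-orthogonal to every evaluator
(`not_isCompleteSystemIn_sonineK_burnolZSystem`). [cite: Burnol2004b, Thm. 3.2 (arXiv:math/0203120v7 p. 6, TeX l.528–531)] -/
theorem Burnol2004b_thm3_2_lt_one {a : ℝ} (ha : 0 < a) (ha1 : a < 1) :
    IsMinimalSystem (burnolZSystem a) ∧ ¬ IsCompleteSystemIn (sonineK a) (burnolZSystem a) :=
  ⟨BurnolZEvaluatorsMinimal.isMinimalSystem_burnolZSystem ha ha1,
    not_isCompleteSystemIn_sonineK_burnolZSystem ha ha1⟩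

/-- **Thm. 3.2 is exactly Props. 6.5 and 6.6 away**: `Burnol2004b_thm3_2_of_constituents` with its
Thm. 6.7 input discharged. [cite: Burnol2004b, Thm. 3.2 and §6 (arXiv:math/0203120v7 pp. 6, 16–17; TeX l.528–539, 1303–1378)] -/
theorem Burnol2004b_thm3_2_of_prop6_5_of_prop6_6 (h65 : Burnol2004b_prop6_5)
    (h66 : Burnol2004b_prop6_6) : Burnol2004b_thm3_2 :=
  Burnol2004b_thm3_2_of_constituents Burnol2004b_thm6_7_holds h65 h66

/-- **Thm. 3.2 is exactly Props. 6.5 and 6.2 away** (Prop. 6.6 being Prop. 6.2 projected,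
`Burnol2004b_prop6_6_of_prop6_2`). [cite: Burnol2004b, Thm. 3.2 and §6 (arXiv:math/0203120v7 pp. 6, 15–17; TeX l.528–539, 1241–1257, 1303–1378)] -/
theorem Burnol2004b_thm3_2_of_prop6_5_of_prop6_2 (h65 : Burnol2004b_prop6_5)
    (h62 : Burnol2004b_prop6_2) : Burnol2004b_thm3_2 :=
  Burnol2004b_thm3_2_of_prop6_5_of_prop6_6 h65 (Burnol2004b_prop6_6_of_prop6_2 h62)

end Literature.NumberTheory.LFunctions

end
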